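import Summits.Ventures.PackingBounds.Energy.GramCongrCheck
import HarnessLib

/-!
# Kernel-checkable congruence `X = B Y Bᵀ`: column-range chunks of a single row

Framing: lottery ticket; floor = certified bounds/negative ranges. Venture `PackingBounds`, cell
`pub-packcert`, energy family E3PT (pub-packcert-energy gen 15; KERNEL-D6 route at SDP degree 8).

`GramData.checkCongr` (module `GramCongrCheck`) checks whole rows `a0 ≤ a < a1` of `X = B Y Bᵀ`; its cost for a
row `a` is proportional to the number of nonzero entries of the row `B_a`, and at SDP degree 8 one monomial row
of the face basis is dense (146 of 158 entries), too much for one gate-sized theorem. `checkCongrCols a b0 b1`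
checks the entries `b0 ≤ b < b1` of ONE row `a` (same recursive evaluator `cgOuter`), `of_checkCongrCols` unpacks
it in the form used to assemble the hypothesis of `GramData.listQuad_nonneg_of_congr`.
-/

namespace Summit.Ventures.PackingBounds.Energy.GramData

/-- Row `a`, columns `b0 ≤ b < b1`: `X_{ab} = Σ_i B_{ai} Σ_j B_{bj} Y_{ij}`. -/
def checkCongrCols (a b0 b1 : ℕ) (B Y X : List (List ℤ)) : Bool :=
  ((List.range b1).filter (fun b => b0 ≤ b)).all fun b =>
    ent X a b == cgOuter Y (B.getD b []) (B.getD a []) 0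

/-- Unpack a checked column chunk of one row of the congruence. -/
theorem of_checkCongrCols {a b0 b1 : ℕ} {B Y X : List (List ℤ)} (h : checkCongrCols a b0 b1 B Y X = true) :
    ∀ b, b0 ≤ b → b < b1 → ent X a b = cgOuter Y (B.getD b []) (B.getD a []) 0 := by
  intro b hb0 hb1
  simp only [checkCongrCols, List.all_eq_true, List.mem_filter, List.mem_range, decide_eq_true_eq,
    beq_iff_eq] at h
  exact h b ⟨hb1, hb0⟩

end Summit.Ventures.PackingBounds.Energy.GramData
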